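/-
Copyright: cell `pub-ymgap` (HUMAN RULING D-0062), Track A of `YM-PLAN.md`, DAG node N20 (= NE7b); R134 acceleration seat
`pub-ymgap-dag-n20-c` (strategy s1, generation 4), module 26.  Released under the licence of the surrounding project.
-/
import Summits.QuantumFields.YangMills.Theorems.BalabanUVNodesN20LCSLargeFieldSubfamilies
import Summits.QuantumFields.YangMills.Theorems.BalabanUVNodesN21StepWeightsPositivity
import HarnessLib

/-!
# YM-DAG node N20 (= NE7b), strategy s1, module 26: OVERLAPPING LETTER REGIONS — greedy sparsification of a pinned family into a sub-family with
# pairwise disjoint regions (`#D ≤ K·#D′`), and the first-step bound with ONE PEIERLS FACTOR PER `K` PINNED CUBES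

Track A of `YM-PLAN.md` (cell `pub-ymgap`, HUMAN RULING D-0062), node **N20** = spine estimate NE7b (`T4WeightBudget.RelWeightBound` — NOT PRINTED,
NOT PROVED).  Seat `pub-ymgap-dag-n20-c` (R134, s1), generation 4, module 26 (17–25 = `…N20LCSLargeField{Labels,FirstStep,Families,Halves,OfMoments,
Subfamilies,RootedAtZero,ClassWeight}`, `…N20LCSLabelPieces`).  Kernel theorems only: 0 `def`, 0 `sorry`, standard axioms; COUNT-NEUTRAL; `--supports`
the K3‴ item.  Nothing of Bałaban's is asserted.

WHY.  Modules 19–25 take the regularity regions `R c` of the pinned cubes PAIRWISE DISJOINT (n20-d's one-witness-per-cell counting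
`measureReal_forall_exists_le_pow` needs it).  The regions of neighbouring cubes overlap (each `R c` is a neighbourhood of `c`); what holds instead is
BOUNDED OVERLAP — every region meets at most `K = K(d, L, ·)` regions of the family.  The standard remedy is to thin the family: a greedy independent
set in the overlap graph keeps at least `#D∕K` cubes with pairwise disjoint regions, so the Peierls exponent stays LINEAR in `#D` with the slope divided by
`K` — print's sparse sub-lattice device for counting large-field cubes ([Balaban1989LargeFieldII] (1.79)–(1.80): one small factor per cube of `Z`, up to
geometric constants).  THIS FILE:
* §0 `zeta_nonneg_of_laws` — the positivity letter `0 ≤ ζ` of modules 23–25 in their binder shape, FROM def-T's two displayed laws `IsZetaUnity`,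
  `IsZetaAbsLeOne` (seat n21-d's `N21StepWeightsPositivity.zetaOfRecord_nonneg`: `Σζ = 1`, `Σ|ζ| ≤ 1` ⇒ `ζ ≥ 0` termwise) — no extra law after all;
* §1 ★ **`exists_disjoint_subfamily`** (generic finite combinatorics): if every region `R c`, `c ∈ D`, meets at most `K ≥ 1` regions of the family, there is
  `D′ ⊆ D` with pairwise disjoint regions and `#D ≤ K·#D′` (strong induction on `#D`: keep a cube, discard the `≤ K` cubes meeting it, recurse on the rest);
* §2 ★★ **`abs_integral_pinnedFamily_rhoZero_le_of_overlap`** — at the first step, modulo `IsZetaAbsLeOne`, `0 ≤ ζ` and the regularity letters, for regions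
  of `≤ m` plaquettes with the bounded-overlap letter in instance-free form (`hover`: the cubes whose regions meet `R c` lie in a set of `≤ K` cubes):
  `∃ D′ ⊆ D, #D ≤ K·#D′ ∧ |∫ (Σ_{t : D ⊆ P(t)} ω s t (U,Ū)) ρ₀ dU| ≤ (m·e^{Cδ₀ − δ₀g₀⁻²ε″²∕(2N)})^{#D′}·∫ρ₀ dU` — module 23's sub-family bound (the labels
  pinning `D` pin `D′`) after §1: ONE PEIERLS FACTOR PER `K` PINNED CUBES; `abs_integral_pinnedFamily_le_of_moments_of_overlap` — the same at any
  performed step from the moment form of «LCS-k» (module 23 ∕ 22's constants).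

HONEST FRAMING.  As modules 19–25 (letters displayed, label-indexed, first step ∕ conditional at `j ≥ 1`); the overlap constant `K` of Bałaban's cube
geometry is the consumer's (a function of `d`, `L` and the enlargement radii, not computed here).  NE7b NOT PRINTED ∕ NOT PROVED; (α)-instance 0∕1; N20 NOT
discharged; typed 28∕28, discharged count untouched; one finite four-torus at fixed `ε` — NOT ℝ⁴, NOT infinite volume, NOT OS, NOT a mass gap, NOT Clay.

References: T. Bałaban, CMP 122 (1989) 355–392 [Balaban1989LargeFieldII] ((1.79)–(1.80) pp. 383–384); CMP 119 (1988) 243–285 [Balaban1988Convergent]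
((3.2) p. 265); CMP 102 (1985) 277–309 [Balaban1985Variational] (Thm 1 p. 279).
-/

set_option autoImplicit false

noncomputable section

open scoped BigOperators

namespace Summit.QuantumFields.YangMills.BalabanUVNodes.N20LCSLargeFieldSparsify

open MeasureTheory
open Literature.MathematicalPhysics.QuantumFieldTheory.Balaban1983to89
open Literature.MathematicalPhysics.QuantumFieldTheory.Balaban1983to89.T4Continuum
open Literature.MathematicalPhysics.QuantumFieldTheory.Balaban1983to89.Node00
open ExpMeanLog (deltaSU)
open Summit.QuantumFields.YangMills.BalabanUVNodes.N20LCSLargeFieldSubfamilies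
  (abs_integral_pinnedSubfamily_rhoZero_le abs_integral_pinnedSubfamily_le_of_moments)
open Summit.QuantumFields.YangMills.Theorems.N21StepWeightsPositivity (zetaOfRecord_nonneg)

/-! ## §0 The positivity letter of modules 23–25 IS a consequence of def-T's two displayed laws (seat n21-d's observation) -/

section Positivity

variable (F : T4Family) (N : ℕ) [NeZero N] (ν : Stage7Numerics) (M : ℕ)

omit [NeZero N] in
/-- **`0 ≤ ζ` FROM `IsZetaUnity ∧ IsZetaAbsLeOne`** (seat `pub-ymgap-dag-n21-d`'s `N21StepWeightsPositivity.zetaOfRecord_nonneg`: a finite real family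
with `Σ ζ = 1` and `Σ|ζ| ≤ 1` is termwise non-negative), in the binder shape `hζ0` of modules 23–25 — so their positivity letter is discharged by the
two laws def-T already displays, at no extra law. [folklore] -/
theorem zeta_nonneg_of_laws {ζ : ZetaOfRecord F N ν M} (hζu : IsZetaUnity F N ν M ζ) (hζ : IsZetaAbsLeOne F N ν M ζ) :
    ∀ (q : B12.RunParams) (g' : ℕ → ℝ) (k' : ℕ) (s : SeqOfRecord F ν M g' q.K k') (Pl Ql : Finset (Iχ F ν q g' k'))
      (RS : Finset (Iχ F ν q g' k') × Finset (Iχ F ν q g' k')) (U : GaugeField (F.P q.K) k' (SU N))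
      (V' : GaugeField (F.P q.K) (k' + 1) (SU N)), 0 ≤ ζ q g' k' s Pl Ql RS U V' :=
  fun q g' k' s Pl Ql RS U V' => zetaOfRecord_nonneg F N ν M hζu hζ q g' k' s Pl Ql RS U V'

end Positivity

/-! ## §1 Greedy sparsification: bounded overlap ⇒ a disjoint sub-family of proportional size -/

section Greedy

variable {κ π : Type*} [DecidableEq κ] [DecidableEq π]

/-- **GREEDY SPARSIFICATION.**  If every region `R c` (`c ∈ D`) meets at most `K ≥ 1` regions of the family (itself included when non-empty), then `D`
has a sub-family `D′` with PAIRWISE DISJOINT regions and `#D ≤ K·#D′` (pick a cube, discard the `≤ K` cubes whose regions meet its region, recurse).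
[folklore] -/
theorem exists_disjoint_subfamily (R : κ → Finset π) {K : ℕ} (hK : 1 ≤ K) :
    ∀ (D : Finset κ), (∀ c ∈ D, (D.filter fun c' => ¬ Disjoint (R c) (R c')).card ≤ K) →
      ∃ D' : Finset κ, D' ⊆ D ∧ (∀ c₁ ∈ D', ∀ c₂ ∈ D', c₁ ≠ c₂ → Disjoint (R c₁) (R c₂)) ∧ D.card ≤ K * D'.card := by
  intro D
  induction' h : D.card using Nat.strong_induction_on with n ih generalizing D
  intro hover
  by_cases hD : D = ∅
  · refine ⟨∅, Finset.empty_subset _, by simp, ?_⟩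
    rw [← h, hD]
    simp
  obtain ⟨c, hc⟩ := Finset.nonempty_iff_ne_empty.2 hD
  -- the cubes whose regions meet `R c`, and `c` itself
  set Nc : Finset κ := insert c (D.filter fun c' => ¬ Disjoint (R c) (R c')) with hNc
  have hNc_card : Nc.card ≤ K := by
    by_cases hRc : R c = ∅
    · have hfil : (D.filter fun c' => ¬ Disjoint (R c) (R c')) = ∅ := by
        refine Finset.filter_eq_empty_iff.2 fun c' _ => ?_
        rw [not_not, hRc]
        exact Finset.disjoint_empty_left _
      rw [hNc, hfil]
      simpa using hK
    · have hcN : c ∈ D.filter fun c' => ¬ Disjoint (R c) (R c') := by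
        refine Finset.mem_filter.2 ⟨hc, ?_⟩
        rw [Finset.disjoint_self_iff_empty]
        exact hRc
      rw [hNc, Finset.insert_eq_of_mem hcN]
      exact hover c hc
  -- recurse on the rest
  set D₁ : Finset κ := D \ Nc with hD₁
  have hD₁sub : D₁ ⊆ D := Finset.sdiff_subset
  have hcNc : c ∈ Nc := Finset.mem_insert_self _ _
  have hlt : D₁.card < n := by
    rw [← h]
    exact Finset.card_lt_card ⟨hD₁sub, fun hsub => (Finset.mem_sdiff.1 (hsub hc)).2 hcNc⟩
  have hover₁ : ∀ c' ∈ D₁, (D₁.filter fun c'' => ¬ Disjoint (R c') (R c'')).card ≤ K := by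
    intro c' hc'
    exact (Finset.card_le_card (Finset.filter_subset_filter _ hD₁sub)).trans (hover c' (hD₁sub hc'))
  obtain ⟨D'', hD''sub, hD''disj, hD''card⟩ := ih D₁.card hlt D₁ rfl hover₁
  refine ⟨insert c D'', ?_, ?_, ?_⟩
  · exact Finset.insert_subset hc (hD''sub.trans hD₁sub)
  · -- pairwise disjointness: new pairs involve `c` and a cube of `D'' ⊆ D \ Nc`
    have hfar : ∀ c' ∈ D'', Disjoint (R c) (R c') := by
      intro c' hc'
      have hmem := hD''sub hc'
      rw [hD₁, Finset.mem_sdiff] at hmem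
      by_contra hnd
      exact hmem.2 (Finset.mem_insert_of_mem (Finset.mem_filter.2 ⟨hmem.1, hnd⟩))
    intro c₁ hc₁ c₂ hc₂ hne
    rcases Finset.mem_insert.1 hc₁ with rfl | h₁
    · rcases Finset.mem_insert.1 hc₂ with rfl | h₂
      · exact absurd rfl hne
      · exact hfar c₂ h₂
    · rcases Finset.mem_insert.1 hc₂ with rfl | h₂
      · exact (hfar c₁ h₁).symm
      · exact hD''disj c₁ h₁ c₂ h₂ hne
  · -- counting: `#D = #Nc ∩ D + #D₁ ≤ K + K·#D''`
    have hcD'' : c ∉ D'' := fun h' => by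
      have := hD''sub h'
      rw [hD₁, Finset.mem_sdiff] at this
      exact this.2 hcNc
    rw [Finset.card_insert_of_notMem hcD'', Nat.mul_succ]
    have hsplit : D.card ≤ Nc.card + D₁.card := by
      rw [hD₁]
      calc D.card ≤ (Nc ∪ (D \ Nc)).card := Finset.card_le_card (fun x hx => by
              by_cases hxN : x ∈ Nc
              · exact Finset.mem_union_left _ hxN
              · exact Finset.mem_union_right _ (Finset.mem_sdiff.2 ⟨hx, hxN⟩))
        _ ≤ Nc.card + (D \ Nc).card := Finset.card_union_le _ _
    rw [← h]
    calc D.card ≤ Nc.card + D₁.card := hsplit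
      _ ≤ K + K * D''.card := Nat.add_le_add hNc_card hD''card
      _ = K * D''.card + K := Nat.add_comm _ _

end Greedy

/-! ## §2 At the record, first step: overlapping regions cost a factor `K` in the exponent -/

section Record

variable (F : T4Family) (N : ℕ) [NeZero N] (ν : Stage7Numerics) (M : ℕ) (p : B12.RunParams) (g : ℕ → ℝ)

/-- **THE FIRST STEP WITH OVERLAPPING LETTER REGIONS.**  With the `δ₀ > 0`, `C ≥ 0` of n20-d's cells Peierls bound: modulo `IsZetaAbsLeOne`, `0 ≤ ζ` and the
regularity letters of the pinned cubes `D` on regions `R c` of `≤ m` plaquettes, the cubes whose regions meet `R c` lying in a set of at most `K ≥ 1`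
cubes (`hover`, instance-free form of «each region meets at most `K` regions of the family»), THERE IS a sub-family
`D′ ⊆ D` with `#D ≤ K·#D′` such that
`|∫ (Σ_{t : D ⊆ P(t)} ω s t (U,Ū)) ρ₀ dU| ≤ (m·e^{Cδ₀ − δ₀g₀⁻²ε″²∕(2N)})^{#D′}·∫ρ₀ dU`
— one Peierls factor per `K` pinned cubes (module 23's sub-family bound at the labels pinning `D`, which pin `D′`, after §1). [folklore] -/
theorem abs_integral_pinnedFamily_rhoZero_le_of_overlap :
    ∃ δ₀ : ℝ, 0 < δ₀ ∧ ∃ C : ℝ, 0 ≤ C ∧ ∀ (_hK : 1 ≤ p.K) (g₀ E₀ : ℝ), 4 * N ≤ g₀⁻¹ ^ 2 →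
      ∀ (A₁ : ℝ) {ζ : ZetaOfRecord F N ν M}, IsZetaAbsLeOne F N ν M ζ →
        (∀ q g' k' (s : SeqOfRecord F ν M g' q.K k') Pl Ql RS U V', 0 ≤ ζ q g' k' s Pl Ql RS U V') →
      ∀ (s : SeqOfRecord F ν M g p.K 0) (D : Finset (Iχ F ν p g 0)) (R : Iχ F ν p g 0 → Finset (Plaq (F.P p.K) 1))
        (m K : ℕ) (ε'' : ℝ), 0 ≤ ε'' → 1 ≤ K → (∀ c ∈ D, (R c).card ≤ m) →
        (∀ c ∈ D, ∃ Nc : Finset (Iχ F ν p g 0), Nc.card ≤ K ∧ ∀ c' ∈ D, ¬ Disjoint (R c) (R c') → c' ∈ Nc) →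
        (∀ c ∈ D, ∀ V' : GaugeField (F.P p.K) 1 (SU N),
          (∀ p' ∈ R c, dist1 (GaugeField.plaqHol V' p') < ε'') → chiFactor F N ν p g 0 c V' = 1) →
        ∃ D' : Finset (Iχ F ν p g 0), D' ⊆ D ∧ D.card ≤ K * D'.card ∧
          |∫ U, (∑ t ∈ Finset.univ.filter (fun t : LbOfRecord F ν p g 0 => D ⊆ t.1),
              ωOfRecord F N ν M p g 0 A₁ ζ s t U ((avOfRecord F N p.K 0).avg U)) * rhoZeroOfRecord F N p.K g₀ E₀ U
              ∂(fieldMeasure (F.P p.K) 0 (SU N))| ≤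
            ((m : ℝ) * Real.exp (C * δ₀ - δ₀ * g₀⁻¹ ^ 2 * (ε'' ^ 2 / (2 * (Fintype.card (Fin N) : ℝ))))) ^ D'.card *
              ∫ U, rhoZeroOfRecord F N p.K g₀ E₀ U ∂(fieldMeasure (F.P p.K) 0 (SU N)) := by
  classical
  obtain ⟨δ₀, hδ₀, C, hC, h⟩ := abs_integral_pinnedSubfamily_rhoZero_le F N ν M p g
  refine ⟨δ₀, hδ₀, C, hC, fun hK g₀ E₀ hg A₁ ζ hζ hζ0 s D R m K ε'' hε hK1 hm hover hreg => ?_⟩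
  have hover' : ∀ c ∈ D, (D.filter fun c' => ¬ Disjoint (R c) (R c')).card ≤ K := by
    intro c hc
    obtain ⟨Nc, hNc, hin⟩ := hover c hc
    exact (Finset.card_le_card fun c' hc' => hin c' (Finset.mem_filter.1 hc').1 (Finset.mem_filter.1 hc').2).trans hNc
  obtain ⟨D', hD'sub, hD'disj, hD'card⟩ := exists_disjoint_subfamily R hK1 D hover'
  refine ⟨D', hD'sub, hD'card, ?_⟩
  exact h hK g₀ E₀ hg A₁ hζ hζ0 s D' (Finset.univ.filter fun t : LbOfRecord F ν p g 0 => D ⊆ t.1)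
    (fun t ht => hD'sub.trans (Finset.mem_filter.1 ht).2) R m ε'' hε (fun c hc => hm c (hD'sub hc))
    (fun c₁ h₁ c₂ h₂ hne => hD'disj c₁ h₁ c₂ h₂ hne) (fun c hc => hreg c (hD'sub hc))


/-- **ANY PERFORMED STEP WITH OVERLAPPING LETTER REGIONS, FROM «LCS-k»** (module 23's `abs_integral_pinnedSubfamily_le_of_moments` after §1): modulo
`IsZetaAbsLeOne`, `0 ≤ ζ`, the regularity letters and the moment form of «LCS-k» for the old piece `f`, there is `D′ ⊆ D` with `#D ≤ K·#D′` and
`|∫ (Σ_{t : D ⊆ P(t)} ω s t (U,Ū))·f dU| ≤ (m·e^{C·A·M·M·δ − δβ·ε″²∕(2N)})^{#D′}·∫ f dU`. [folklore] -/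
theorem abs_integral_pinnedFamily_le_of_moments_of_overlap (k : ℕ) (hk : k < p.K) {α : ℝ} (hα : 0 < α)
    (hguard : (((((F.P p.K).d + 2) * (F.P p.K).L : ℕ) : ℝ) ^ 2 / 4) * Real.sqrt (2 * (Fintype.card (Fin N) : ℝ) * α) <
      deltaSU (Fin N))
    (A₁ : ℝ) {ζ : ZetaOfRecord F N ν M} (hζ : IsZetaAbsLeOne F N ν M ζ)
    (hζ0 : ∀ q g' k' (s : SeqOfRecord F ν M g' q.K k') Pl Ql RS U V', 0 ≤ ζ q g' k' s Pl Ql RS U V')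
    (s : SeqOfRecord F ν M g p.K k)
    {f : GaugeField (F.P p.K) k (SU N) → ℝ} (hfm : Measurable f) (hf0 : ∀ U, 0 ≤ f U)
    (hf : Integrable f (fieldMeasure (F.P p.K) k (SU N))) {β : ℝ} (hβ : 0 ≤ β) {C a₀ : ℝ} (hC : 0 ≤ C)
    (hLS : ∀ a : ℝ, 0 ≤ a → a ≤ a₀ → ∀ X : Finset (Plaq (F.P p.K) k),
      ∫ U, Real.exp (a * β * ∑ q ∈ X, (1 - reTr (GaugeField.plaqHol U q))) * f U ∂(fieldMeasure (F.P p.K) k (SU N)) ≤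
        Real.exp (C * a * X.card) * ∫ U, f U ∂(fieldMeasure (F.P p.K) k (SU N)))
    {δ : ℝ} (hδ0 : 0 ≤ δ)
    (hδ : δ * ((2 * (Fintype.card (Fin N) : ℝ) * (((F.P p.K).L : ℝ) ^ 2 + 6 * ((((F.P p.K).d + 2) * (F.P p.K).L : ℕ) : ℝ) ^ 2) ^ 2 + 2 / α) *
      (((2 * (((F.P p.K).d + 3) * (F.P p.K).L + 2) + 1) ^ (F.P p.K).d * (F.P p.K).d ^ 2 : ℕ) : ℝ)) ≤ a₀)
    (D : Finset (Iχ F ν p g k)) (R : Iχ F ν p g k → Finset (Plaq (F.P p.K) (k + 1))) (m K : ℕ) {ε'' : ℝ} (hε : 0 ≤ ε'') (hK1 : 1 ≤ K)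
    (hm : ∀ c ∈ D, (R c).card ≤ m)
    (hover : ∀ c ∈ D, ∃ Nc : Finset (Iχ F ν p g k), Nc.card ≤ K ∧ ∀ c' ∈ D, ¬ Disjoint (R c) (R c') → c' ∈ Nc)
    (hreg : ∀ c ∈ D, ∀ V' : GaugeField (F.P p.K) (k + 1) (SU N),
      (∀ p' ∈ R c, dist1 (GaugeField.plaqHol V' p') < ε'') → chiFactor F N ν p g k c V' = 1) :
    ∃ D' : Finset (Iχ F ν p g k), D' ⊆ D ∧ D.card ≤ K * D'.card ∧
      |∫ U, (∑ t ∈ Finset.univ.filter (fun t : LbOfRecord F ν p g k => D ⊆ t.1),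
          ωOfRecord F N ν M p g k A₁ ζ s t U ((avOfRecord F N p.K k).avg U)) * f U ∂(fieldMeasure (F.P p.K) k (SU N))| ≤
        ((m : ℝ) * Real.exp (C * ((2 * (Fintype.card (Fin N) : ℝ) *
              (((F.P p.K).L : ℝ) ^ 2 + 6 * ((((F.P p.K).d + 2) * (F.P p.K).L : ℕ) : ℝ) ^ 2) ^ 2 + 2 / α) *
            (((2 * (((F.P p.K).d + 3) * (F.P p.K).L + 2) + 1) ^ (F.P p.K).d * (F.P p.K).d ^ 2 : ℕ) : ℝ)) *
            (((2 * (((F.P p.K).d + 3) * (F.P p.K).L + 2) + 1) ^ (F.P p.K).d * (F.P p.K).d ^ 2 : ℕ) : ℝ) * δ -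
              δ * β * (ε'' ^ 2 / (2 * (Fintype.card (Fin N) : ℝ))))) ^ D'.card *
          ∫ U, f U ∂(fieldMeasure (F.P p.K) k (SU N)) := by
  classical
  have hover' : ∀ c ∈ D, (D.filter fun c' => ¬ Disjoint (R c) (R c')).card ≤ K := by
    intro c hc
    obtain ⟨Nc, hNc, hin⟩ := hover c hc
    exact (Finset.card_le_card fun c' hc' => hin c' (Finset.mem_filter.1 hc').1 (Finset.mem_filter.1 hc').2).trans hNc
  obtain ⟨D', hD'sub, hD'disj, hD'card⟩ := exists_disjoint_subfamily R hK1 D hover'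
  refine ⟨D', hD'sub, hD'card, ?_⟩
  exact abs_integral_pinnedSubfamily_le_of_moments F N ν M p g k hk hα hguard A₁ hζ hζ0 s hfm hf0 hf hβ hC hLS hδ0 hδ D'
    (Finset.univ.filter fun t : LbOfRecord F ν p g k => D ⊆ t.1) (fun t ht => hD'sub.trans (Finset.mem_filter.1 ht).2) R m hε
    (fun c hc => hm c (hD'sub hc)) (fun c₁ h₁ c₂ h₂ hne => hD'disj c₁ h₁ c₂ h₂ hne) (fun c hc => hreg c (hD'sub hc))

end Record

end Summit.QuantumFields.YangMills.BalabanUVNodes.N20LCSLargeFieldSparsify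

end
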